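import Mathlib
import Literature.NumberTheory.LFunctions.Zhang2022.Section15Eq1523Edge
import HarnessLib

/-!
# Zhang (2022) §15 (15.22)→(15.23)→(15.24): the closing chain GENERIC IN THE VALUE of `𝔢ⱼ`
# (RT-05 E-chain producing edges of WP15; theorems only)

Topic `Literature/NumberTheory/LFunctions/Zhang2022` (Landau–Siegel audit tree; verdict-neutral).
Y. Zhang, *Discrete mean estimates and the Landau–Siegel zero*, arXiv:2211.02515v1 (2022)
[Zhang2022LandauSiegel] — an unrefereed manuscript under adjudication; nothing here asserts or denies
its Theorems 1–2. Lane ZHANG-L, RE-TYPE RT-05 (zl-lead R-22/R-28, zl-ref-chief C1–C5: the 𝔢-chain is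
carried PARAMETRISED over the value of `e″₁ⱼ` and instantiated at the DERIVED `AppendixB.e1ppD`): the
WP15 producing edges of the (15.24) chain — `Ded1524.eq15_23R_of_eq15_22_rate1`,
`eta_small_of_rate1`, `coeff_eventually`, `eval1524_of_coeff`, `eval1524_of_rates_R` (files
`Section15U056Rate`, `Section15Eq1523Edge`, `Section15Eval1524`) — re-proved VERBATIM with the
constants `𝔢ⱼ = frake j` replaced by an ARBITRARY `e : ℕ → ℂ` (the proofs use only
`‖e j‖ ≤ ‖e 1‖ + ‖e 2‖ + ‖e 3‖`, as the cell's cost notes recorded: "constant-agnostic"). Conclusions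
are EXPLICIT formulas, so that the E-twins of record (`Typed.Section15C.Eq15_22E/Eq15_23RE e1pp`,
`Skeleton.Eval1524(Rel)E e1pp`, zl-skel's chain file) apply them at `e := frakeE e1pp` by unfolding,
and the printed chain is the instance `e := frake`. No new claims; no definitions.
WHAT THIS IS NOT: a proof of (15.22) or of any leaf, nor any claim about Theorems 1–2 of the manuscript
or Landau–Siegel zeros.

## References
* Y. Zhang, arXiv:2211.02515v1 (2022), §15 pp. 87–88, (15.22)–(15.24). [cite: Zhang2022LandauSiegel, §15 (15.24) p.88]
-/

noncomputable section

open Complex Real ComplexConjugate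
open Literature.NumberTheory.LFunctions.Zhang2022.Skeleton
open Literature.NumberTheory.LFunctions.Zhang2022.Typed

namespace Literature.NumberTheory.LFunctions.Zhang2022.Ded1524

/-! ## 0. Pointwise algebra (copies of the private helpers of `Section15Eval1524`) -/

/-- `t·(u·S) − m·e·A = (u − m)·e·A + t·u·(S − e·A/t)` (`t ≠ 0`). [cite: Zhang2022LandauSiegel, §15 (15.24) p.88] -/
private theorem comb_identity_g (t u S m e A : ℂ) (ht : t ≠ 0) :
    t * (u * S) - m * e * A = (u - m) * e * A + t * u * (S - e * A * t⁻¹) := by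
  field_simp
  ring

/-- `‖t(uS) − meA‖ ≤ ‖u − m‖‖e‖A + t(‖m‖ + ‖u − m‖)‖S − eA/t‖` (`t > 0`, `A ≥ 0`).
[cite: Zhang2022LandauSiegel, §15 (15.24) p.88] -/
private theorem norm_comb_le_g {t A : ℝ} (ht : 0 < t) (hA : 0 ≤ A) (u S m e : ℂ) :
    ‖(t : ℂ) * (u * S) - m * e * A‖ ≤
      ‖u - m‖ * ‖e‖ * A + t * (‖m‖ + ‖u - m‖) * ‖S - e * A * (t : ℂ)⁻¹‖ := by
  rw [comb_identity_g (t : ℂ) u S m e A (by exact_mod_cast ht.ne')]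
  refine (norm_add_le _ _).trans ?_
  have h1 : ‖(u - m) * e * (A : ℂ)‖ = ‖u - m‖ * ‖e‖ * A := by
    rw [norm_mul, norm_mul, Complex.norm_of_nonneg hA]
  have h2 : ‖(t : ℂ) * u * (S - e * A * (t : ℂ)⁻¹)‖ ≤
      t * (‖m‖ + ‖u - m‖) * ‖S - e * A * (t : ℂ)⁻¹‖ := by
    rw [norm_mul, norm_mul, Complex.norm_of_nonneg ht.le]
    gcongr
    calc ‖u‖ = ‖m + (u - m)‖ := by ring_nf
      _ ≤ ‖m‖ + ‖u - m‖ := norm_add_le _ _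
  rw [h1]
  linarith

/-- `‖e j‖ ≤ ‖e 1‖ + ‖e 2‖ + ‖e 3‖` for `j ∈ {1,2,3}`. [folklore] -/
private theorem norm_le_K3 (e : ℕ → ℂ) {j : ℕ} (hj : j ∈ ({1, 2, 3} : Finset ℕ)) :
    ‖e j‖ ≤ ‖e 1‖ + ‖e 2‖ + ‖e 3‖ := by
  simp only [Finset.mem_insert, Finset.mem_singleton] at hj
  rcases hj with rfl | rfl | rfl <;>
    linarith [norm_nonneg (e 1), norm_nonneg (e 2), norm_nonneg (e 3)]

/-! ## 1. (15.22)@e + [u056 at rate O(1/𝓛)] ⇒ (15.23)ᴿ@e -/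

/-- **(15.22) with constants `e` and u056 at the rate `O(1/𝓛)` give (15.23) with `O(1/𝓛)` and the same
constants `e`** — `Ded1524.eq15_23R_of_eq15_22_rate1` verbatim with `frake ↦ e` (any instantiation
`X`). E-chain use: `e := frakeE e1pp` gives `Typed.Section15C.Eq15_22E e1pp c′ X → … → Eq15_23RE e1pp c′ X`.
[cite: Zhang2022LandauSiegel, §15 (15.23) p.88] -/
theorem eq15_23_of_eq15_22_rate1_gen (e : ℕ → ℂ) (c' : ℝ) (X : Section15C.Inputs15AB)
    (h22 : ∃ C : ℝ, ForAllLarge fun D _ χ => AssumptionA D χ → ∀ j ∈ ({1, 2, 3} : Finset ℕ),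
      ‖X.calS1 c' χ j - e j * X.calM1 c' χ 1 1 (1 - betaJ c' D j) * Section15C.sumInN c' X χ j‖ ≤
        C / ell D)
    (h56 : ∃ C : ℝ, ForAllLarge fun D _ χ => AssumptionA D χ → ∀ j ∈ ({1, 2, 3} : Finset ℕ),
      ‖X.calM1 c' χ 1 1 (1 - betaJ c' D j) * Section15C.sumInN c' X χ j -
        (frakA χ : ℂ) * (Nat.totient D : ℂ) / (D : ℂ)‖ ≤ C / ell D) :
    ∃ C : ℝ, ForAllLarge fun D _ χ => AssumptionA D χ → ∀ j ∈ ({1, 2, 3} : Finset ℕ),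
      ‖X.calS1 c' χ j - e j * (frakA χ : ℂ) * (Nat.totient D : ℂ) / (D : ℂ)‖ ≤ C / ell D := by
  obtain ⟨C, hC⟩ := h22
  obtain ⟨C', hC'⟩ := h56
  set K : ℝ := ‖e 1‖ + ‖e 2‖ + ‖e 3‖ with hK
  obtain ⟨D₀, h⟩ := hC.and hC'
  refine ⟨|C| + K * |C'|, D₀, fun D _ χ hD hq hp hA j hj => ?_⟩
  obtain ⟨h1, h2⟩ := h D χ hD hq hp
  have g1 := h1 hA j hj
  have g2 := h2 hA j hj
  have hℓ : 0 ≤ ell D := Real.log_natCast_nonneg D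
  have hKj : ‖e j‖ ≤ K := by rw [hK]; exact norm_le_K3 e hj
  set Mv : ℂ := X.calM1 c' χ 1 1 (1 - betaJ c' D j) * Section15C.sumInN c' X χ j with hMv
  have key : X.calS1 c' χ j - e j * (frakA χ : ℂ) * (Nat.totient D : ℂ) / (D : ℂ) =
      (X.calS1 c' χ j - e j * X.calM1 c' χ 1 1 (1 - betaJ c' D j) * Section15C.sumInN c' X χ j) +
        e j * (Mv - (frakA χ : ℂ) * (Nat.totient D : ℂ) / (D : ℂ)) := by
    rw [hMv]; ring
  rw [key]
  have e1 : ‖X.calS1 c' χ j - e j * X.calM1 c' χ 1 1 (1 - betaJ c' D j) *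
      Section15C.sumInN c' X χ j‖ ≤ |C| / ell D := g1.trans (by gcongr; exact le_abs_self C)
  have e2 : ‖e j * (Mv - (frakA χ : ℂ) * (Nat.totient D : ℂ) / (D : ℂ))‖ ≤ K * (|C'| / ell D) := by
    rw [norm_mul]
    exact mul_le_mul hKj (g2.trans (by gcongr; exact le_abs_self C')) (norm_nonneg _) (by positivity)
  calc ‖(X.calS1 c' χ j - e j * X.calM1 c' χ 1 1 (1 - betaJ c' D j) * Section15C.sumInN c' X χ j) +
        e j * (Mv - (frakA χ : ℂ) * (Nat.totient D : ℂ) / (D : ℂ))‖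
      ≤ |C| / ell D + K * (|C'| / ell D) := (norm_add_le _ _).trans (add_le_add e1 e2)
    _ = (|C| + K * |C'|) / ell D := by ring

/-! ## 2. `(D/φ(D))·|𝒮₁ⱼ − eⱼ𝔞φ(D)/D| → 0` from the rate `O(1/𝓛)` -/

/-- The rate `O(1/𝓛)` of (15.23)ᴿ with constants `e` gives `(D/φ(D))·|𝒮₁ⱼ − eⱼ𝔞φ(D)/D| → 0`
(`D/φ(D) ≤ 2 log 𝓛`, `log 𝓛/𝓛 → 0`) — `eta_small_of_rate1` verbatim with `frake ↦ e`.
[cite: Zhang2022LandauSiegel, §15 (15.23) p.88] -/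
theorem eta_small_of_rate1_gen (e : ℕ → ℂ) {S : ∀ (D : ℕ) [NeZero D], DirichletCharacter ℂ D → ℕ → ℂ}
    (h23 : ∃ C : ℝ, ForAllLarge fun D _ χ => AssumptionA D χ → ∀ j ∈ ({1, 2, 3} : Finset ℕ),
      ‖S D χ j - e j * (frakA χ : ℂ) * (Nat.totient D : ℂ) / (D : ℂ)‖ ≤ C / ell D) :
    ∀ ε : ℝ, 0 < ε → ForAllLarge fun D _ χ => AssumptionA D χ → ∀ j ∈ ({1, 2, 3} : Finset ℕ),
      (D : ℝ) / Nat.totient D * ‖S D χ j - e j * (frakA χ : ℂ) * (Nat.totient D : ℂ) / (D : ℂ)‖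
        ≤ ε := by
  intro ε hε
  obtain ⟨C, hC⟩ := h23
  obtain ⟨D₁, hD₁⟩ := self_div_totient_le_two_mul_loglog
  set M : ℝ := max 1 ((4 * |C| / ε) ^ 2) with hM
  have hT : ForAllLarge fun D _ _ => M ≤ ell D ∧ (D : ℝ) / Nat.totient D ≤ 2 * Real.log (ell D) := by
    refine ForAllLarge.of_le (max ⌈Real.exp M⌉₊ D₁) fun D _ _ hD _ _ => ⟨?_, hD₁ D ?_⟩
    · have h : Real.exp M ≤ D :=
        le_trans (Nat.le_ceil _) (by exact_mod_cast (le_max_left _ _).trans hD)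
      exact (Real.le_log_iff_exp_le (lt_of_lt_of_le (Real.exp_pos _) h)).mpr h
    · exact (le_max_right _ _).trans hD
  obtain ⟨D₀, h⟩ := hC.and hT
  refine ⟨D₀, fun D _ χ hD hq hp hA j hj => ?_⟩
  obtain ⟨h1, hMℓ, ht⟩ := h D χ hD hq hp
  have hℓ1 : 1 ≤ ell D := (le_max_left _ _).trans hMℓ
  have hℓ0 : 0 < ell D := by linarith
  have hCε : (4 * |C| / ε) ^ 2 ≤ ell D := (le_max_right _ _).trans hMℓ
  have hη : ‖S D χ j - e j * (frakA χ : ℂ) * (Nat.totient D : ℂ) / (D : ℂ)‖ ≤ |C| / ell D :=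
    (h1 hA j hj).trans (by gcongr; exact le_abs_self C)
  have ht0 : 0 ≤ (D : ℝ) / Nat.totient D := by positivity
  have hs0 : 0 < Real.sqrt (ell D) := Real.sqrt_pos.mpr hℓ0
  have hlog : Real.log (ell D) ≤ 2 * Real.sqrt (ell D) := by
    have h := Real.log_le_rpow_div hℓ0.le (by norm_num : (0:ℝ) < 1 / 2)
    rw [Real.sqrt_eq_rpow]
    linarith
  have hsq : 4 * |C| / ε ≤ Real.sqrt (ell D) := by
    have h0 : 0 ≤ 4 * |C| / ε := by positivity
    calc 4 * |C| / ε = Real.sqrt ((4 * |C| / ε) ^ 2) := (Real.sqrt_sq h0).symm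
      _ ≤ Real.sqrt (ell D) := Real.sqrt_le_sqrt hCε
  have hss : Real.sqrt (ell D) * Real.sqrt (ell D) = ell D := Real.mul_self_sqrt hℓ0.le
  have h4 : 4 * |C| ≤ ε * Real.sqrt (ell D) := by
    rw [div_le_iff₀ hε] at hsq; linarith
  calc (D : ℝ) / Nat.totient D * ‖S D χ j - e j * (frakA χ : ℂ) * (Nat.totient D : ℂ) / (D : ℂ)‖
      ≤ (2 * Real.log (ell D)) * (|C| / ell D) :=
        mul_le_mul ht hη (norm_nonneg _) (by linarith [Real.log_nonneg hℓ1])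
    _ ≤ (2 * (2 * Real.sqrt (ell D))) * (|C| / ell D) := by gcongr
    _ = 4 * |C| * Real.sqrt (ell D) / ell D := by ring
    _ ≤ ε * Real.sqrt (ell D) * Real.sqrt (ell D) / ell D := by gcongr
    _ = ε := by rw [mul_assoc, hss]; field_simp

/-! ## 3. The coefficient limit `(D/φ(D))·Σⱼ ℛ₁*ℛ₁ⱼ𝒮₁ⱼ → (e₁ + 2e₂ + e₃)𝔞` -/

/-- **The coefficient of `p` in (15.17) tends to `(e₁ + 2e₂ + e₃)𝔞`** — `coeff_eventually` verbatim
with `frake ↦ e`. [cite: Zhang2022LandauSiegel, §15 (15.24) p.88] -/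
theorem coeff_eventually_gen (e : ℕ → ℂ) {S R : ∀ (D : ℕ) [NeZero D], DirichletCharacter ℂ D → ℕ → ℂ}
    {Rs : ∀ (D : ℕ) [NeZero D], DirichletCharacter ℂ D → ℂ}
    (hη : ∀ ε : ℝ, 0 < ε → ForAllLarge fun D _ χ => AssumptionA D χ → ∀ j ∈ ({1, 2, 3} : Finset ℕ),
      (D : ℝ) / Nat.totient D * ‖S D χ j - e j * (frakA χ : ℂ) * (Nat.totient D : ℂ) / (D : ℂ)‖
        ≤ ε)
    (hδ : ∀ ε : ℝ, 0 < ε → ForAllLarge fun D _ χ => AssumptionA D χ →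
      (‖Rs D χ * R D χ 1 - 1‖ + ‖Rs D χ * R D χ 2 - 2‖ + ‖Rs D χ * R D χ 3 - 1‖) *
        (1 + frakA χ) ≤ ε) :
    ∀ ε : ℝ, 0 < ε → ForAllLarge fun D _ χ => AssumptionA D χ →
      ‖((D : ℝ) / Nat.totient D : ℝ) * ∑ j ∈ ({1, 2, 3} : Finset ℕ), Rs D χ * R D χ j * S D χ j -
          (e 1 + 2 * e 2 + e 3) * frakA χ‖ ≤ ε := by
  intro ε hε
  set K : ℝ := ‖e 1‖ + ‖e 2‖ + ‖e 3‖ with hK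
  have hK0 : 0 ≤ K := by positivity
  set ε₁ : ℝ := min 1 (ε / (6 * (K + 1))) with hε₁
  have hε₁0 : 0 < ε₁ := lt_min one_pos (by positivity)
  have hε₁1 : ε₁ ≤ 1 := min_le_left _ _
  have hε₁K : ε₁ * (6 * (K + 1)) ≤ ε := by
    have := min_le_right 1 (ε / (6 * (K + 1)))
    rwa [← hε₁, le_div_iff₀ (by positivity)] at this
  obtain ⟨D₀, h⟩ := (hη (ε / 18) (by positivity)).and (hδ ε₁ hε₁0)
  refine ⟨D₀, fun D _ χ hD hq hp hA => ?_⟩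
  obtain ⟨h1, h2⟩ := h D χ hD hq hp
  have h1 := h1 hA
  have h2 := h2 hA
  have hD0 : 0 < D := Nat.pos_of_ne_zero (NeZero.ne D)
  have hφ0 : 0 < (Nat.totient D : ℝ) := by exact_mod_cast Nat.totient_pos.mpr hD0
  set t : ℝ := (D : ℝ) / Nat.totient D with ht
  have ht0 : 0 < t := div_pos (by exact_mod_cast hD0) hφ0
  have hA0 : 0 ≤ frakA χ := frakA_nonneg χ
  have hinv : ((Nat.totient D : ℂ)) / (D : ℂ) = ((t : ℝ) : ℂ)⁻¹ := by
    rw [ht]; push_cast; rw [inv_div]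
  have hsum : ((t : ℝ) : ℂ) * ∑ j ∈ ({1, 2, 3} : Finset ℕ), Rs D χ * R D χ j * S D χ j -
      (e 1 + 2 * e 2 + e 3) * frakA χ =
      (((t : ℝ) : ℂ) * (Rs D χ * R D χ 1 * S D χ 1) - 1 * e 1 * frakA χ) +
      (((t : ℝ) : ℂ) * (Rs D χ * R D χ 2 * S D χ 2) - 2 * e 2 * frakA χ) +
      (((t : ℝ) : ℂ) * (Rs D χ * R D χ 3 * S D χ 3) - 1 * e 3 * frakA χ) := by
    rw [Finset.sum_insert (by simp), Finset.sum_insert (by simp), Finset.sum_singleton]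
    ring
  rw [hsum]
  set δs : ℝ := ‖Rs D χ * R D χ 1 - 1‖ + ‖Rs D χ * R D χ 2 - 2‖ + ‖Rs D χ * R D χ 3 - 1‖ with hδs
  have hδs0 : 0 ≤ δs := by positivity
  have hδs1 : δs ≤ ε₁ := by nlinarith
  have hδsA : δs * frakA χ ≤ ε₁ := by nlinarith
  have piece : ∀ j ∈ ({1, 2, 3} : Finset ℕ), ∀ m : ℂ, ‖m‖ ≤ 2 → ‖Rs D χ * R D χ j - m‖ ≤ δs →
      ‖((t : ℝ) : ℂ) * (Rs D χ * R D χ j * S D χ j) - m * e j * frakA χ‖ ≤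
        K * ε₁ + 3 * (ε / 18) := by
    intro j hj m hm hu
    have hηj : t * ‖S D χ j - e j * (frakA χ : ℂ) * ((t : ℝ) : ℂ)⁻¹‖ ≤ ε / 18 := by
      have := h1 j hj; rwa [mul_div_assoc, hinv] at this
    have hKj : ‖e j‖ ≤ K := by rw [hK]; exact norm_le_K3 e hj
    have huA : ‖Rs D χ * R D χ j - m‖ * frakA χ ≤ ε₁ :=
      (mul_le_mul_of_nonneg_right hu hA0).trans hδsA
    have hu1 : ‖Rs D χ * R D χ j - m‖ ≤ 1 := hu.trans (hδs1.trans hε₁1)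
    calc ‖((t : ℝ) : ℂ) * (Rs D χ * R D χ j * S D χ j) - m * e j * frakA χ‖
        ≤ ‖Rs D χ * R D χ j - m‖ * ‖e j‖ * frakA χ +
            t * (‖m‖ + ‖Rs D χ * R D χ j - m‖) *
              ‖S D χ j - e j * frakA χ * ((t : ℝ) : ℂ)⁻¹‖ :=
          norm_comb_le_g ht0 hA0 (Rs D χ * R D χ j) (S D χ j) m (e j)
      _ = ‖e j‖ * (‖Rs D χ * R D χ j - m‖ * frakA χ) +
            (‖m‖ + ‖Rs D χ * R D χ j - m‖) *
              (t * ‖S D χ j - e j * frakA χ * ((t : ℝ) : ℂ)⁻¹‖) := by ring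
      _ ≤ K * ε₁ + (2 + 1) * (ε / 18) := by gcongr
      _ = K * ε₁ + 3 * (ε / 18) := by ring
  have n1 := norm_nonneg (Rs D χ * R D χ 1 - 1)
  have n2 := norm_nonneg (Rs D χ * R D χ 2 - 2)
  have n3 := norm_nonneg (Rs D χ * R D χ 3 - 1)
  have hm1 : ‖(1 : ℂ)‖ ≤ 2 := by simp
  have hm2 : ‖(2 : ℂ)‖ ≤ 2 := by simp
  have hp1 := piece 1 (by simp) 1 hm1 (by rw [hδs]; linarith)
  have hp2 := piece 2 (by simp) 2 hm2 (by rw [hδs]; linarith)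
  have hp3 := piece 3 (by simp) 1 hm1 (by rw [hδs]; linarith)
  calc ‖(((t : ℝ) : ℂ) * (Rs D χ * R D χ 1 * S D χ 1) - 1 * e 1 * frakA χ) +
        (((t : ℝ) : ℂ) * (Rs D χ * R D χ 2 * S D χ 2) - 2 * e 2 * frakA χ) +
        (((t : ℝ) : ℂ) * (Rs D χ * R D χ 3 * S D χ 3) - 1 * e 3 * frakA χ)‖
      ≤ ‖((t : ℝ) : ℂ) * (Rs D χ * R D χ 1 * S D χ 1) - 1 * e 1 * frakA χ‖ +
        ‖((t : ℝ) : ℂ) * (Rs D χ * R D χ 2 * S D χ 2) - 2 * e 2 * frakA χ‖ +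
        ‖((t : ℝ) : ℂ) * (Rs D χ * R D χ 3 * S D χ 3) - 1 * e 3 * frakA χ‖ :=
          (norm_add_le _ _).trans (by gcongr; exact norm_add_le _ _)
    _ ≤ (K * ε₁ + 3 * (ε / 18)) + (K * ε₁ + 3 * (ε / 18)) + (K * ε₁ + 3 * (ε / 18)) :=
          add_le_add (add_le_add hp1 hp2) hp3
    _ = 3 * K * ε₁ + ε / 2 := by ring
    _ ≤ ε := by nlinarith

/-! ## 4. (15.24) with constants `e`: `Φ₁ = (e₁ + 2e₂ + e₃)𝔞𝔓 + o(𝔓)` -/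

/-- **The last step of §15 with constants `e`** — `eval1524_of_coeff` verbatim with `frake ↦ e`,
conclusion written out (`Skeleton.Eval1524` is its `e := frake` instance; the E-chain's `Eval1524E
e1pp` its `e := frakeE e1pp` instance). [cite: Zhang2022LandauSiegel, §15 (15.24) p.88] -/
theorem eval1524_of_coeff_gen (e : ℕ → ℂ) {c' : ℝ}
    {Φp S R : ∀ (D : ℕ) [NeZero D], DirichletCharacter ℂ D → ℕ → ℂ}
    {Rs : ∀ (D : ℕ) [NeZero D], DirichletCharacter ℂ D → ℂ}
    (h6 : ∀ ε : ℝ, 0 < ε → ForAllLarge fun D _ χ => AssumptionA D χ →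
      ‖Phi1 c' χ - ∑ p ∈ primeWindow D, Φp D χ p‖ ≤ ε * frakP D)
    (h17 : ∀ ε : ℝ, 0 < ε → ForAllLarge fun D _ χ => AssumptionA D χ → ∀ p ∈ primeWindow D,
      ‖Φp D χ p - Rs D χ * (D : ℂ) * (p : ℂ) / (Nat.totient D : ℂ) *
          ∑ j ∈ ({1, 2, 3} : Finset ℕ), R D χ j * S D χ j‖ ≤ ε * p)
    (hcoeff : ∀ ε : ℝ, 0 < ε → ForAllLarge fun D _ χ => AssumptionA D χ →
      ‖((D : ℝ) / Nat.totient D : ℝ) * ∑ j ∈ ({1, 2, 3} : Finset ℕ), Rs D χ * R D χ j * S D χ j -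
          (e 1 + 2 * e 2 + e 3) * frakA χ‖ ≤ ε) :
    ∀ ε : ℝ, 0 < ε → ForAllLarge fun D _ χ => AssumptionA D χ →
      ‖Phi1 c' χ - (e 1 + 2 * e 2 + e 3) * frakA χ * frakP D‖ ≤ ε * frakP D := by
  intro ε hε
  have hε3 : 0 < ε / 3 := by positivity
  obtain ⟨D₀, h⟩ := ((h6 _ hε3).and (h17 _ hε3)).and (hcoeff _ hε3)
  refine ⟨D₀, fun D _ χ hD hq hp hA => ?_⟩
  obtain ⟨⟨e6, e17⟩, ec⟩ := h D χ hD hq hp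
  have g6 := e6 hA
  have g17 := e17 hA
  have gc := ec hA
  set c : ℂ := e 1 + 2 * e 2 + e 3 with hc
  set t : ℝ := (D : ℝ) / Nat.totient D with ht
  set E : ℂ := ((t : ℝ) : ℂ) * ∑ j ∈ ({1, 2, 3} : Finset ℕ), Rs D χ * R D χ j * S D χ j -
    c * frakA χ with hE
  set mainp : ℕ → ℂ := fun p => Rs D χ * (D : ℂ) * (p : ℂ) / (Nat.totient D : ℂ) *
    ∑ j ∈ ({1, 2, 3} : Finset ℕ), R D χ j * S D χ j with hmainp
  have hD0 : 0 < D := Nat.pos_of_ne_zero (NeZero.ne D)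
  have hφ : (Nat.totient D : ℂ) ≠ 0 := by exact_mod_cast (Nat.totient_pos.mpr hD0).ne'
  have hP0 : 0 ≤ frakP D := frakP_nonneg D
  have key : ∀ p : ℕ, mainp p - (p : ℂ) * (c * frakA χ) = (p : ℂ) * E := by
    intro p
    have hs : ∑ j ∈ ({1, 2, 3} : Finset ℕ), Rs D χ * R D χ j * S D χ j =
        Rs D χ * ∑ j ∈ ({1, 2, 3} : Finset ℕ), R D χ j * S D χ j := by
      rw [Finset.mul_sum]; exact Finset.sum_congr rfl fun j _ => by ring
    simp only [hmainp, hE, hs, ht]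
    push_cast
    field_simp
  have hPE : (frakP D : ℂ) * E = ∑ p ∈ primeWindow D, (p : ℂ) * E := by
    rw [frakP_eq_sum_primeWindow]; push_cast; rw [Finset.sum_mul]
  have hcP : c * frakA χ * frakP D = ∑ p ∈ primeWindow D, (p : ℂ) * (c * frakA χ) := by
    rw [frakP_eq_sum_primeWindow]; push_cast; rw [Finset.mul_sum]
    exact Finset.sum_congr rfl fun p _ => by ring
  have decomp : Phi1 c' χ - c * frakA χ * frakP D =
      (Phi1 c' χ - ∑ p ∈ primeWindow D, Φp D χ p) +
        ∑ p ∈ primeWindow D, (Φp D χ p - mainp p) + (frakP D : ℂ) * E := by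
    rw [hPE, hcP, Finset.sum_sub_distrib]
    have : ∑ p ∈ primeWindow D, (p : ℂ) * E =
        ∑ p ∈ primeWindow D, mainp p - ∑ p ∈ primeWindow D, (p : ℂ) * (c * frakA χ) := by
      rw [← Finset.sum_sub_distrib]; exact Finset.sum_congr rfl fun p _ => (key p).symm
    rw [this]; ring
  rw [decomp]
  have hsum17 : ‖∑ p ∈ primeWindow D, (Φp D χ p - mainp p)‖ ≤ ε / 3 * frakP D := by
    refine (norm_sum_le _ _).trans ?_
    rw [frakP_eq_sum_primeWindow, Finset.mul_sum]
    exact Finset.sum_le_sum fun p hp' => g17 p hp'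
  have hPEn : ‖(frakP D : ℂ) * E‖ ≤ ε / 3 * frakP D := by
    rw [norm_mul, Complex.norm_of_nonneg hP0, mul_comm]
    exact mul_le_mul_of_nonneg_right gc hP0
  calc ‖(Phi1 c' χ - ∑ p ∈ primeWindow D, Φp D χ p) +
          ∑ p ∈ primeWindow D, (Φp D χ p - mainp p) + (frakP D : ℂ) * E‖
      ≤ ‖Phi1 c' χ - ∑ p ∈ primeWindow D, Φp D χ p‖ +
          ‖∑ p ∈ primeWindow D, (Φp D χ p - mainp p)‖ + ‖(frakP D : ℂ) * E‖ :=
        (norm_add_le _ _).trans (by gcongr; exact norm_add_le _ _)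
    _ ≤ ε / 3 * frakP D + ε / 3 * frakP D + ε / 3 * frakP D := add_le_add (add_le_add g6 hsum17) hPEn
    _ = ε * frakP D := by ring

/-- **(15.24) with constants `e` from (15.6), (15.17), (15.23)ᴿ@e (rate `O(1/𝓛)`) and
`ℛ₁*ℛ₁ⱼ = (1,2,1) + O(𝓛⁻⁵)`** — `eval1524_of_rates_R` verbatim with `frake ↦ e`, conclusion written
out. This is the producing edge the skeleton's E-chain (RT-05) composes at `e := frakeE e1pp` with
`Ded1524.u056_rate1_of_partsRel` (𝔢-free) and `prod_rate5_of_values_rel` (𝔢-free).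
[cite: Zhang2022LandauSiegel, §15 (15.24) p.88] -/
theorem eval1524_of_rates_R_gen (e : ℕ → ℂ) {c' : ℝ}
    {Φp S R : ∀ (D : ℕ) [NeZero D], DirichletCharacter ℂ D → ℕ → ℂ}
    {Rs : ∀ (D : ℕ) [NeZero D], DirichletCharacter ℂ D → ℂ}
    (h6 : ∀ ε : ℝ, 0 < ε → ForAllLarge fun D _ χ => AssumptionA D χ →
      ‖Phi1 c' χ - ∑ p ∈ primeWindow D, Φp D χ p‖ ≤ ε * frakP D)
    (h17 : ∀ ε : ℝ, 0 < ε → ForAllLarge fun D _ χ => AssumptionA D χ → ∀ p ∈ primeWindow D,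
      ‖Φp D χ p - Rs D χ * (D : ℂ) * (p : ℂ) / (Nat.totient D : ℂ) *
          ∑ j ∈ ({1, 2, 3} : Finset ℕ), R D χ j * S D χ j‖ ≤ ε * p)
    (h23R : ∃ C : ℝ, ForAllLarge fun D _ χ => AssumptionA D χ → ∀ j ∈ ({1, 2, 3} : Finset ℕ),
      ‖S D χ j - e j * (frakA χ : ℂ) * (Nat.totient D : ℂ) / (D : ℂ)‖ ≤ C / ell D)
    (hprod : ∃ C : ℝ, ForAllLarge fun D _ χ => AssumptionA D χ →
      ‖Rs D χ * R D χ 1 - 1‖ ≤ C / ell D ^ 5 ∧ ‖Rs D χ * R D χ 2 - 2‖ ≤ C / ell D ^ 5 ∧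
        ‖Rs D χ * R D χ 3 - 1‖ ≤ C / ell D ^ 5) :
    ∀ ε : ℝ, 0 < ε → ForAllLarge fun D _ χ => AssumptionA D χ →
      ‖Phi1 c' χ - (e 1 + 2 * e 2 + e 3) * frakA χ * frakP D‖ ≤ ε * frakP D :=
  eval1524_of_coeff_gen e h6 h17
    (coeff_eventually_gen e (eta_small_of_rate1_gen e h23R) (delta_small_of_rate5 hprod))

end Literature.NumberTheory.LFunctions.Zhang2022.Ded1524
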